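import Summits.CriticalPhenomena.SAWScalingLimit.Theorems.SAWDevelopingMapObservableToSLETypeLadderBandDefs
import Summits.CriticalPhenomena.SAWScalingLimit.Theorems.SAWDefectDecoherenceObservableToSLERGateDecomposition
import HarnessLib

/-!
# Prefix conditioning: the one-sided domain-Markov inequality for the critical hexagonal SAW

Stub `stub_prefixConditioning` (piece I2 of the band iteration, reshape r16 of the line
`six-class-type-ladder`) for the crux `…Theses.SAWDevelopingMap.ObservableToSLE`
(item stmt-CriticalPhenomena-10472).  The critical SAW of a lattice domain `Ω_δ ⊆ δℍ` from `u` to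
`b` is domain-Markov: conditionally on its EXIT PREFIX `ω₀ : u → t` from the closed `r`-ball about
`z` (the prefix up to and including the first vertex farther than `r` from `z`; it exists as soon as
`b` is farther than `r`), the remainder is a critical SAW of `Ω_δ` from the tip `t` avoiding the
other prefix vertices, i.e. it has the carved law `carvedLaw Ω δ {v ∈ ω₀ | v ≠ t} t b`.  Hence if an
event `F` of the vertex list is decided by the exit prefix and `G` has carved probability `≤ c`
after every exit prefix with `F`, then `P(F ∧ G) ≤ c · P(F)`.  Bookkeeping: walk surgery (adapted
from the `δℤ²` domain-Markov file `Theorems/SAWLeftRightFKGFKGToTraversalBoundDomainMarkov.lean`);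
`embWeight_prefix`, the exact prefix factorisation of the `x^{ℓ}`-weight of an embedded graph
(`q ↦ ω₀ · q` is a weight-shifting bijection; `embWeight_eq_mul_of_equiv` of the `GateDecomposition`
file); `embWeight_eq_tsum_fibre` + `exists_exitPrefix` + `exitPrefix_eq`, the weight of an event is
the sum over exit prefixes of the weights of its fibres; `fibre_weight_le`, the carved bound on one
fibre.  No finiteness is used (all sums are `ℝ≥0∞`-valued `tsum`s; an infinite total weight makes
the law the junk `0`).  Sources: H. Kesten, J. Math. Phys. 4 (1963) §4; N. Madras, G. Slade, *The
Self-Avoiding Walk* (1993) §1.2; G. Lawler, O. Schramm, W. Werner, Proc. Sympos. Pure Math. 72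
(2004) §3.4.
-/

noncomputable section

open scoped BigOperators Topology NNReal ENNReal Classical
open Filter Set MeasureTheory Metric
open Literature.Probability.LatticeModels (HexVertex hexGraph hexCenter)
open Literature.Probability.RandomPlanarGeometry
open Literature.Probability.RandomPlanarGeometry.SAW

namespace Summit.CriticalPhenomena.SAWScalingLimit.Theorems.ObservableToSLE.TypeLadder

open Summit.CriticalPhenomena.SAWScalingLimit.Theorems.ObservableToSLER.BridgeGate (carvedLaw carvedWeight
  support_getLast?_eq embDomainSAW_eq_of_walk_eq embWeight_apply_eq_tsum embWeight_eq_mul_of_equiv)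

/-! ### Walks of a graph, SAWs of an embedded graph: prefix factorisation and exit prefixes -/

section Embedded

variable {V : Type*} {G : SimpleGraph V} {emb : V → ℂ} {Ω : Set ℂ} {δ : ℝ}

-- adapted from `FKGToTraversalBound.ExcursionDomination.isPath_append_iff`
/-- A concatenation `p · q` is self-avoiding iff both pieces are and `q` meets `p` only at the
junction. [folklore] -/
theorem isPath_append_iff {u v w : V} (p : G.Walk u v) (q : G.Walk v w) :
    (p.append q).IsPath ↔ p.IsPath ∧ q.IsPath ∧ ∀ x ∈ q.support, x ∈ p.support → x = v := by
  rw [SimpleGraph.Walk.isPath_def, SimpleGraph.Walk.isPath_def, SimpleGraph.Walk.isPath_def,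
    SimpleGraph.Walk.support_append, List.nodup_append, ← q.cons_tail_support, List.nodup_cons]
  constructor
  · rintro ⟨hp, htail, hdisj⟩
    have hv : v ∉ q.support.tail := fun hv => hdisj v p.end_mem_support v hv rfl
    refine ⟨hp, ⟨hv, htail⟩, fun x hx hxp => ?_⟩
    rcases List.mem_cons.1 hx with rfl | hx
    · rfl
    · exact absurd rfl (hdisj x hxp x hx)
  · rintro ⟨hp, ⟨hv, htail⟩, hcompat⟩
    refine ⟨hp, htail, fun x hxp y hy hxy => ?_⟩
    subst hxy
    have := hcompat x (List.mem_cons_of_mem _ hy) hxp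
    subst this
    exact hv hy

/-- Two walks from `a` with the same support are the same point of `Σ t, G.Walk a t`. [folklore] -/
theorem sigma_eq_of_support_eq {a t₁ t₂ : V} (π₁ : G.Walk a t₁) (π₂ : G.Walk a t₂)
    (h : π₁.support = π₂.support) : (⟨t₁, π₁⟩ : Σ t, G.Walk a t) = ⟨t₂, π₂⟩ := by
  have ht : t₁ = t₂ := by
    have h₁ := support_getLast?_eq π₁
    rw [h, support_getLast?_eq π₂] at h₁
    exact (Option.some_injective _ h₁).symm
  subst ht
  rw [SimpleGraph.Walk.ext_support h]

/-- The first `|p| + 1` vertices of `p · q` are those of `p`. [folklore] -/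
theorem getVert_append_of_le {u v w : V} (p : G.Walk u v) (q : G.Walk v w) {n : ℕ}
    (hn : n ≤ p.length) : (p.append q).getVert n = p.getVert n := by
  rw [SimpleGraph.Walk.getVert_append]
  rcases hn.lt_or_eq with h | rfl
  · rw [if_pos h]
  · rw [if_neg (lt_irrefl _), Nat.sub_self, SimpleGraph.Walk.getVert_zero,
      SimpleGraph.Walk.getVert_length]

/-- The support of `p · q` truncated after `|p| + 1` entries is the support of `p`. [folklore] -/
theorem take_support_append {u v w : V} (p : G.Walk u v) (q : G.Walk v w) :
    (p.append q).support.take (p.length + 1) = p.support := by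
  rw [SimpleGraph.Walk.support_append, List.take_left' (p.length_support)]

-- adapted from `FKGToTraversalBound.ExcursionDomination.weight_prefix` (the `δℤ²` chord measure)
/-- **Prefix factorisation** (one-sided domain Markov property of the `x^{ℓ}`-weights, `x ≥ 0`).
For a self-avoiding prefix `π : a → t` of `Ω_δ` and an event `P` read on the vertex list of the
future, the weight of the SAWs `a → b` of the form `π · q` with `P q` is `x^{|π|}` times the weight of
the SAWs `q : t → b` meeting `π` only at `t` with `P q` (`q ↦ π · q` is a bijection shifting the
number of vertices by `|π|`).  Madras–Slade 1993 §1.2. [folklore] -/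
theorem embWeight_prefix {x : ℝ} (hx : 0 ≤ x) {a b t : V} (π : (embDomainGraph G emb Ω δ).Walk a t)
    (hπ : π.IsPath) (P : List V → Prop) :
    embWeight G emb Ω δ x a b
        {γ | ∃ q : (embDomainGraph G emb Ω δ).Walk t b, γ.walk = π.append q ∧ P q.support} =
      ENNReal.ofReal (x ^ π.length) *
        embWeight G emb Ω δ x t b
          {γ' | (∀ v ∈ γ'.walk.support, v ∈ π.support → v = t) ∧ P γ'.walk.support} := by
  set A : Set (EmbDomainSAW G emb Ω δ a b) :=
    {γ | ∃ q : (embDomainGraph G emb Ω δ).Walk t b, γ.walk = π.append q ∧ P q.support}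
  set A' : Set (EmbDomainSAW G emb Ω δ t b) :=
    {γ' | (∀ v ∈ γ'.walk.support, v ∈ π.support → v = t) ∧ P γ'.walk.support}
  have hpath : ∀ γ' : A', (π.append γ'.1.walk).IsPath := fun γ' =>
    (isPath_append_iff π γ'.1.walk).2 ⟨hπ, γ'.1.isPath, γ'.2.1⟩
  let Φ : A' → A := fun γ' => ⟨⟨π.append γ'.1.walk, hpath γ'⟩, γ'.1.walk, rfl, γ'.2.2⟩
  have hΦwalk : ∀ γ' : A', ((Φ γ' : A) : EmbDomainSAW G emb Ω δ a b).walk = π.append γ'.1.walk :=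
    fun _ => rfl
  have hΦinj : Function.Injective Φ := by
    intro γ₁ γ₂ h
    have h' := congrArg (fun γ : A => (γ : EmbDomainSAW G emb Ω δ a b).walk.support) h
    simp only [hΦwalk, SimpleGraph.Walk.support_append] at h'
    refine Subtype.ext (embDomainSAW_eq_of_walk_eq (SimpleGraph.Walk.ext_support ?_))
    rw [← γ₁.1.walk.cons_tail_support, ← γ₂.1.walk.cons_tail_support, List.append_cancel_left h']
  have hΦsurj : Function.Surjective Φ := by
    rintro ⟨γ, q, hq, hP⟩
    obtain ⟨-, hqp, hcompat⟩ := (isPath_append_iff π q).1 (hq ▸ γ.isPath)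
    exact ⟨⟨⟨q, hqp⟩, hcompat, hP⟩, Subtype.ext (embDomainSAW_eq_of_walk_eq (by rw [hΦwalk, hq]))⟩
  refine embWeight_eq_mul_of_equiv hx A A' _ (Equiv.ofBijective Φ ⟨hΦinj, hΦsurj⟩) fun γ' => ?_
  rw [Equiv.ofBijective_apply]
  show ((Φ γ' : A) : EmbDomainSAW G emb Ω δ a b).walk.length + 1 = π.length + (γ'.1.walk.length + 1)
  rw [hΦwalk, SimpleGraph.Walk.length_append, add_assoc]

/-- The weight of an event is the sum of the weights of its traces on the classes of a
classification of the SAWs with exactly one class per SAW. [folklore] -/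
theorem embWeight_eq_tsum_fibre {ι : Type*} (x : ℝ) {a b : V}
    (S : ι → Set (EmbDomainSAW G emb Ω δ a b)) (h : ∀ γ, ∃! i, γ ∈ S i)
    (A : Set (EmbDomainSAW G emb Ω δ a b)) :
    embWeight G emb Ω δ x a b A = ∑' i, embWeight G emb Ω δ x a b (S i ∩ A) := by
  rw [embWeight_apply_eq_tsum, tsum_subtype A fun γ : EmbDomainSAW G emb Ω δ a b =>
    ENNReal.ofReal (x ^ γ.vertexCount)]
  simp only [embWeight_apply_eq_tsum, tsum_subtype (S _ ∩ A) fun γ : EmbDomainSAW G emb Ω δ a b =>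
    ENNReal.ofReal (x ^ γ.vertexCount), ← Set.indicator_indicator]
  rw [ENNReal.tsum_comm]
  refine tsum_congr fun γ => ?_
  obtain ⟨i₀, hi₀, huniq⟩ := h γ
  rw [tsum_eq_single i₀ fun i hi => Set.indicator_of_notMem (fun hmem => hi (huniq i hmem)) _,
    Set.indicator_of_mem hi₀]

/-- **Existence of the exit prefix.**  If the endpoint `b` is farther than `r` from `z`, every SAW
`a → b` of `Ω_δ` splits as `π · q` with `π : a → t` self-avoiding, every vertex of `π` other than
`t` within `r` of `z`, and `t` farther than `r` (cut at the first far vertex). [folklore] -/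
theorem exists_exitPrefix {a b : V} (z : ℂ) (r : ℝ) (hb : r < dist ((δ : ℂ) * emb b) z)
    (γ : EmbDomainSAW G emb Ω δ a b) :
    ∃ p : Σ t, (embDomainGraph G emb Ω δ).Walk a t,
      (p.2.IsPath ∧ (∀ v ∈ p.2.support, v ≠ p.1 → dist ((δ : ℂ) * emb v) z ≤ r) ∧
          r < dist ((δ : ℂ) * emb p.1) z) ∧
        ∃ q : (embDomainGraph G emb Ω δ).Walk p.1 b, γ.walk = p.2.append q := by
  have hex : ∃ n, n ≤ γ.walk.length ∧ r < dist ((δ : ℂ) * emb (γ.walk.getVert n)) z :=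
    ⟨γ.walk.length, le_rfl, by rw [SimpleGraph.Walk.getVert_length]; exact hb⟩
  obtain ⟨hnlen, hnfar⟩ := Nat.find_spec hex
  have hmin : ∀ m, m < Nat.find hex → dist ((δ : ℂ) * emb (γ.walk.getVert m)) z ≤ r := by
    intro m hm
    have h := Nat.find_min hex hm
    rw [not_and, not_lt] at h
    exact h (hm.le.trans hnlen)
  refine ⟨⟨γ.walk.getVert (Nat.find hex), γ.walk.take (Nat.find hex)⟩, ⟨?_, ?_, hnfar⟩,
    γ.walk.drop (Nat.find hex), (γ.walk.append_take_drop_eq _).symm⟩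
  · have h := γ.isPath
    rw [← γ.walk.append_take_drop_eq (Nat.find hex)] at h
    exact h.of_append_left
  · intro v hv hvt
    obtain ⟨m, hm, -⟩ := SimpleGraph.Walk.mem_support_iff_exists_getVert.1 hv
    rw [SimpleGraph.Walk.take_getVert] at hm
    rcases (min_le_left (Nat.find hex) m).lt_or_eq with hlt | heq
    · rw [← hm]
      exact hmin _ hlt
    · exact absurd (by rw [← hm, heq]) hvt

/-- Of two splittings `π₁ · q₁ = π₂ · q₂` of one walk, a prefix `π₁` with far tip is at least as long
as a self-avoiding prefix `π₂` whose non-tip vertices are close (else the tip of `π₁` would be a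
non-tip vertex of `π₂`). [folklore] -/
theorem length_le_of_exitPrefix {a b t₁ t₂ : V} (z : ℂ) (r : ℝ) {w : G.Walk a b} {π₁ : G.Walk a t₁}
    {π₂ : G.Walk a t₂} {q₁ : G.Walk t₁ b} {q₂ : G.Walk t₂ b} (h₁ : w = π₁.append q₁)
    (h₂ : w = π₂.append q₂)
    (hπ₂ : π₂.IsPath) (hS₂ : ∀ v ∈ π₂.support, v ≠ t₂ → dist ((δ : ℂ) * emb v) z ≤ r)
    (ht₁ : r < dist ((δ : ℂ) * emb t₁) z) : π₂.length ≤ π₁.length := by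
  by_contra h
  have h' : π₁.length < π₂.length := not_le.1 h
  have hv : π₂.getVert π₁.length = t₁ := by
    rw [← getVert_append_of_le π₂ q₂ h'.le, ← h₂, h₁, getVert_append_of_le π₁ q₁ le_rfl,
      SimpleGraph.Walk.getVert_length]
  have hne : t₁ ≠ t₂ := fun h'' => h'.ne ((hπ₂.getVert_eq_end_iff h'.le).1 (hv.trans h''))
  exact (not_lt.2 (hS₂ t₁ (hv ▸ SimpleGraph.Walk.getVert_mem_support _ _) hne)) ht₁

/-- **Uniqueness of the exit prefix.**  Two admissible splittings `π₁ · q₁ = π₂ · q₂` of one walk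
(self-avoiding prefixes whose non-tip vertices are within `r` of `z` and whose tips are farther)
have the same prefix. [folklore] -/
theorem exitPrefix_eq {a b t₁ t₂ : V} (z : ℂ) (r : ℝ) {w : G.Walk a b} {π₁ : G.Walk a t₁}
    {π₂ : G.Walk a t₂} {q₁ : G.Walk t₁ b} {q₂ : G.Walk t₂ b} (h₁ : w = π₁.append q₁)
    (h₂ : w = π₂.append q₂) (hπ₁ : π₁.IsPath) (hπ₂ : π₂.IsPath)
    (hS₁ : ∀ v ∈ π₁.support, v ≠ t₁ → dist ((δ : ℂ) * emb v) z ≤ r)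
    (hS₂ : ∀ v ∈ π₂.support, v ≠ t₂ → dist ((δ : ℂ) * emb v) z ≤ r)
    (ht₁ : r < dist ((δ : ℂ) * emb t₁) z) (ht₂ : r < dist ((δ : ℂ) * emb t₂) z) :
    (⟨t₁, π₁⟩ : Σ t, G.Walk a t) = ⟨t₂, π₂⟩ := by
  have hlen : π₁.length = π₂.length :=
    le_antisymm (length_le_of_exitPrefix z r h₂ h₁ hπ₁ hS₁ ht₂)
      (length_le_of_exitPrefix z r h₁ h₂ hπ₂ hS₂ ht₁)
  refine sigma_eq_of_support_eq π₁ π₂ ?_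
  rw [← take_support_append π₁ q₁, ← take_support_append π₂ q₂, ← h₁, ← h₂, hlen]

/-- **An event decided by the exit prefix is constant on the fibre of an admissible prefix.**
[folklore] -/
theorem iff_on_fibre_of_decided {a b t : V} (z : ℂ) (r : ℝ) (F : List V → Prop)
    (hF : ∀ (l : List V) (i : ℕ) (hi : i < l.length),
      (∀ (k : ℕ) (hk : k < l.length), k < i → dist ((δ : ℂ) * emb (l[k]'hk)) z ≤ r) →
      r < dist ((δ : ℂ) * emb (l[i]'hi)) z → (F l ↔ F (l.take (i + 1))))
    (π : G.Walk a t) (hπ : π.IsPath) (hS : ∀ v ∈ π.support, v ≠ t → dist ((δ : ℂ) * emb v) z ≤ r)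
    (ht : r < dist ((δ : ℂ) * emb t) z) (q : G.Walk t b) :
    F (π.append q).support ↔ F π.support := by
  have hlen : π.length < (π.append q).support.length := by
    rw [SimpleGraph.Walk.length_support, SimpleGraph.Walk.length_append]
    omega
  have key := hF (π.append q).support π.length hlen ?_ ?_
  · rwa [take_support_append π q] at key
  · intro k hk hki
    rw [SimpleGraph.Walk.support_getElem_eq_getVert, getVert_append_of_le π q hki.le]
    exact hS _ (SimpleGraph.Walk.getVert_mem_support _ _) fun h =>
      hki.ne ((hπ.getVert_eq_end_iff hki.le).1 h)
  · rwa [SimpleGraph.Walk.support_getElem_eq_getVert, getVert_append_of_le π q le_rfl,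
      SimpleGraph.Walk.getVert_length]

end Embedded

/-! ### The hexagonal lattice: the carved bound on a fibre, and the registered statement -/

section Hex

variable {Ω : Set ℂ} {δ : ℝ}

/-- The carved weight avoiding the non-tip vertices of a prefix `π : u → t` is the critical weight
of the SAWs from `t` meeting `π` only at `t`. [folklore] -/
theorem carvedWeight_prefix_apply {u t b : HexVertex} (π : (hexDomainGraph Ω δ).Walk u t)
    (B : Set (HexDomainSAW Ω δ t b)) :
    carvedWeight Ω δ {v | v ∈ π.support ∧ v ≠ t} t b B =
      hexSAWWeight Ω δ t b {γ' | (∀ v ∈ γ'.walk.support, v ∈ π.support → v = t) ∧ γ' ∈ B} := by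
  rw [carvedWeight, Measure.restrict_apply MeasurableSpace.measurableSet_top]
  congr 1
  ext γ'
  simp only [Set.mem_inter_iff, Set.mem_setOf_eq, not_and, not_not]
  exact ⟨fun h => ⟨h.2, h.1⟩, fun h => ⟨h.2, h.1⟩⟩

/-- **The weight inequality on one fibre.**  For an admissible prefix `π : u → t`, decidedness of
`F`, the carved bound `≤ c` for `G` after `π` (if `F π`), and a finite total weight, the weight of
the fibre of `π` met with `{F ∧ G}` is at most `c` times that of the fibre met with `{F}`. [folklore] -/
theorem fibre_weight_le {u b t : HexVertex} (z : ℂ) (r c : ℝ) (F G : List HexVertex → Prop)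
    (hF : ∀ (l : List HexVertex) (i : ℕ) (hi : i < l.length),
      (∀ (k : ℕ) (hk : k < l.length), k < i → dist ((δ : ℂ) * hexCenter (l[k]'hk)) z ≤ r) →
      r < dist ((δ : ℂ) * hexCenter (l[i]'hi)) z → (F l ↔ F (l.take (i + 1))))
    (π : (hexDomainGraph Ω δ).Walk u t) (hπ : π.IsPath)
    (hS : ∀ v ∈ π.support, v ≠ t → dist ((δ : ℂ) * hexCenter v) z ≤ r)
    (ht : r < dist ((δ : ℂ) * hexCenter t) z)
    (hG : F π.support → carvedLaw Ω δ {v | v ∈ π.support ∧ v ≠ t} t b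
      {η | G (π.support ++ η.walk.support.tail)} ≤ ENNReal.ofReal c)
    (hZ : hexSAWWeight Ω δ u b Set.univ ≠ ∞) :
    hexSAWWeight Ω δ u b ({γ | ∃ q : (hexDomainGraph Ω δ).Walk t b, γ.walk = π.append q} ∩
        {γ | F γ.walk.support ∧ G γ.walk.support}) ≤
      ENNReal.ofReal c * hexSAWWeight Ω δ u b
        ({γ | ∃ q : (hexDomainGraph Ω δ).Walk t b, γ.walk = π.append q} ∩
          {γ | F γ.walk.support ∧ True}) := by
  have hFq : ∀ q : (hexDomainGraph Ω δ).Walk t b, F (π.append q).support ↔ F π.support :=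
    iff_on_fibre_of_decided z r F hF π hπ hS ht
  by_cases hFπ : F π.support
  · -- both traces are prefix events of the form of `embWeight_prefix`
    have eH : ∀ H : List HexVertex → Prop,
        ({γ | ∃ q : (hexDomainGraph Ω δ).Walk t b, γ.walk = π.append q} ∩
          {γ | F γ.walk.support ∧ H γ.walk.support} : Set (HexDomainSAW Ω δ u b)) =
        {γ | ∃ q : (hexDomainGraph Ω δ).Walk t b, γ.walk = π.append q ∧
          H (π.support ++ q.support.tail)} := by
      refine fun H => Set.ext fun γ => ⟨?_, ?_⟩
      · rintro ⟨⟨q, hq⟩, -, hHγ⟩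
        rw [hq, SimpleGraph.Walk.support_append] at hHγ
        exact ⟨q, hq, hHγ⟩
      · rintro ⟨q, hq, hHq⟩
        refine ⟨⟨q, hq⟩, ?_⟩
        rw [Set.mem_setOf_eq, hq, SimpleGraph.Walk.support_append]
        exact ⟨(SimpleGraph.Walk.support_append π q) ▸ (hFq q).2 hFπ, hHq⟩
    have hx : 0 ≤ hexCriticalFugacity := hexCriticalFugacity_pos_lt_one.1.le
    have f1 := embWeight_prefix (b := b) hx π hπ (fun l => G (π.support ++ l.tail))
    have f2 := embWeight_prefix (b := b) hx π hπ (fun _ => True)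
    -- the two factors are carved weights
    set U := carvedWeight Ω δ {v | v ∈ π.support ∧ v ≠ t} t b Set.univ with hU
    set W := carvedWeight Ω δ {v | v ∈ π.support ∧ v ≠ t} t b
      {η | G (π.support ++ η.walk.support.tail)} with hW
    have hU' : hexSAWWeight Ω δ t b
        {γ' | (∀ v ∈ γ'.walk.support, v ∈ π.support → v = t) ∧ True} = U := by
      rw [hU, carvedWeight_prefix_apply]
      simp only [Set.mem_univ]
    have hW' : hexSAWWeight Ω δ t b {γ' | (∀ v ∈ γ'.walk.support, v ∈ π.support → v = t) ∧
        G (π.support ++ γ'.walk.support.tail)} = W := by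
      rw [hW, carvedWeight_prefix_apply]
      rfl
    change hexSAWWeight Ω δ u b _ = _ * hexSAWWeight Ω δ t b _ at f1 f2
    rw [hW'] at f1
    rw [hU'] at f2
    -- the fibre has finite total weight, so the carved bound is a weight inequality
    have hUfin : U ≠ ∞ := by
      intro hUtop
      have hle : hexSAWWeight Ω δ u b
          {γ | ∃ q : (hexDomainGraph Ω δ).Walk t b, γ.walk = π.append q ∧ True} ≤
          hexSAWWeight Ω δ u b Set.univ := measure_mono (Set.subset_univ _)
      rw [f2, hUtop, ENNReal.mul_top
        (ENNReal.ofReal_pos.2 (pow_pos hexCriticalFugacity_pos_lt_one.1 _)).ne'] at hle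
      exact hZ (le_antisymm le_top hle)
    have hkey : W ≤ ENNReal.ofReal c * U := by
      by_cases hU0 : U = 0
      · have hWU : W ≤ U := measure_mono (Set.subset_univ _)
        rw [hU0] at hWU ⊢
        exact hWU.trans bot_le
      · have hlaw : U⁻¹ * W ≤ ENNReal.ofReal c := by
          have h := hG hFπ
          rwa [carvedLaw, Measure.smul_apply, smul_eq_mul] at h
        calc W = U * (U⁻¹ * W) := by rw [← mul_assoc, ENNReal.mul_inv_cancel hU0 hUfin, one_mul]
          _ ≤ U * ENNReal.ofReal c := mul_le_mul_right hlaw U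
          _ = ENNReal.ofReal c * U := mul_comm _ _
    rw [eH G, eH fun _ => True, f1, f2]
    exact (mul_le_mul_right hkey _).trans_eq (mul_left_comm _ _ _)
  · -- `F` fails on the whole fibre
    have e0 : ({γ | ∃ q : (hexDomainGraph Ω δ).Walk t b, γ.walk = π.append q} ∩
        {γ | F γ.walk.support ∧ G γ.walk.support} : Set (HexDomainSAW Ω δ u b)) = ∅ := by
      refine Set.eq_empty_iff_forall_notMem.2 ?_
      rintro γ ⟨⟨q, hq⟩, hFγ, -⟩
      rw [hq] at hFγ
      exact hFπ ((hFq q).1 hFγ)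
    rw [e0, measure_empty]
    exact bot_le

/-- STUB `stub_prefixConditioning` (piece I2 of the band iteration) — **prefix conditioning, the
exact domain-Markov factorisation of the critical hexagonal SAW law through the carved law, as an
inequality.**  `F` is decided by the exit prefix from the closed `r`-ball about `z` (the prefix up
to and including the first entry farther than `r` from `z`); `G` has carved probability `≤ c` after
EVERY self-avoiding exit prefix `ω₀ : u → t` with `F` (the future is a critical SAW of `Ω_δ` from
the tip `t` avoiding the other prefix vertices, law `carvedLaw Ω δ {v ∈ ω₀ | v ≠ t} t b`); then
`P(F ∧ G) ≤ c · P(F)` for `hexSAWLaw Ω δ u b`.  Proof: sum the fibrewise inequalities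
`fibre_weight_le` over the exit prefixes (`embWeight_eq_tsum_fibre`, `exists_exitPrefix`,
`exitPrefix_eq`) and normalise (an infinite total weight makes the law the junk `0`).
Kesten 1963 §4; Madras–Slade 1993 §1.2; Lawler–Schramm–Werner 2004 §3.4. [folklore] -/
theorem stub_prefixConditioning :
    ∀ (Ω : Set ℂ) (δ r c : ℝ) (z : ℂ) (u b : HexVertex) (F G : List HexVertex → Prop), 0 ≤ c →
      r < dist ((δ : ℂ) * hexCenter b) z →
      (∀ (l : List HexVertex) (i : ℕ) (hi : i < l.length),
          (∀ (k : ℕ) (hk : k < l.length), k < i → dist ((δ : ℂ) * hexCenter (l[k]'hk)) z ≤ r) →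
          r < dist ((δ : ℂ) * hexCenter (l[i]'hi)) z → (F l ↔ F (l.take (i + 1)))) →
      (∀ (t : HexVertex) (ω₀ : (hexDomainGraph Ω δ).Walk u t), ω₀.IsPath → F ω₀.support →
          (∀ v ∈ ω₀.support, v ≠ t → dist ((δ : ℂ) * hexCenter v) z ≤ r) →
          r < dist ((δ : ℂ) * hexCenter t) z →
          carvedLaw Ω δ {v | v ∈ ω₀.support ∧ v ≠ t} t b
              {η | G (ω₀.support ++ η.walk.support.tail)} ≤ ENNReal.ofReal c) →
      hexSAWLaw Ω δ u b {γ | F γ.walk.support ∧ G γ.walk.support} ≤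
        ENNReal.ofReal c * hexSAWLaw Ω δ u b {γ | F γ.walk.support} := by
  intro Ω δ r c z u b F G _ hb hF hG
  simp only [embLaw, Measure.smul_apply, smul_eq_mul]
  by_cases hZ : hexSAWWeight Ω δ u b Set.univ = ∞
  · rw [show embWeight hexGraph hexCenter Ω δ hexCriticalFugacity u b Set.univ = ∞ from hZ,
      ENNReal.inv_top, zero_mul]
    exact bot_le
  · -- the weight inequality suffices; it is proved fibre by fibre over the exit prefixes
    suffices hW : hexSAWWeight Ω δ u b {γ | F γ.walk.support ∧ G γ.walk.support} ≤
        ENNReal.ofReal c * hexSAWWeight Ω δ u b {γ | F γ.walk.support} from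
      (mul_le_mul_right hW _).trans_eq (mul_left_comm _ _ _)
    set S : (Σ t, (hexDomainGraph Ω δ).Walk u t) → Set (HexDomainSAW Ω δ u b) := fun p =>
      {γ | (p.2.IsPath ∧ (∀ v ∈ p.2.support, v ≠ p.1 → dist ((δ : ℂ) * hexCenter v) z ≤ r) ∧
          r < dist ((δ : ℂ) * hexCenter p.1) z) ∧
        ∃ q : (hexDomainGraph Ω δ).Walk p.1 b, γ.walk = p.2.append q} with hSdef
    have huniq : ∀ γ : HexDomainSAW Ω δ u b, ∃! p, γ ∈ S p := by
      intro γ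
      obtain ⟨⟨t₁, π₁⟩, ⟨hπ₁, hS₁, ht₁⟩, q₁, hq₁⟩ := exists_exitPrefix (G := hexGraph) z r hb γ
      refine ⟨⟨t₁, π₁⟩, ⟨⟨hπ₁, hS₁, ht₁⟩, q₁, hq₁⟩, ?_⟩
      rintro ⟨t₂, π₂⟩ ⟨⟨hπ₂, hS₂, ht₂⟩, q₂, hq₂⟩
      exact exitPrefix_eq z r hq₂ hq₁ hπ₂ hπ₁ hS₂ hS₁ ht₂ ht₁
    rw [embWeight_eq_tsum_fibre hexCriticalFugacity S huniq {γ | F γ.walk.support ∧ G γ.walk.support},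
      embWeight_eq_tsum_fibre hexCriticalFugacity S huniq {γ | F γ.walk.support},
      ← ENNReal.tsum_mul_left]
    refine ENNReal.tsum_le_tsum fun p => ?_
    obtain ⟨t, π⟩ := p
    by_cases hadm : π.IsPath ∧ (∀ v ∈ π.support, v ≠ t → dist ((δ : ℂ) * hexCenter v) z ≤ r) ∧
        r < dist ((δ : ℂ) * hexCenter t) z
    · have hSp : S ⟨t, π⟩ = {γ | ∃ q : (hexDomainGraph Ω δ).Walk t b, γ.walk = π.append q} :=
        Set.ext fun γ => ⟨fun h => h.2, fun h => ⟨hadm, h⟩⟩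
      rw [hSp]
      simpa only [and_true] using fibre_weight_le z r c F G hF π hadm.1 hadm.2.1 hadm.2.2
        (fun hFπ => hG t π hadm.1 hFπ hadm.2.1 hadm.2.2) hZ
    · have hSp : S ⟨t, π⟩ = ∅ := Set.eq_empty_iff_forall_notMem.2 fun γ h => hadm h.1
      rw [hSp, Set.empty_inter, measure_empty]
      exact bot_le

end Hex

end Summit.CriticalPhenomena.SAWScalingLimit.Theorems.ObservableToSLE.TypeLadder

end
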